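import Literature.Computability.Complexity.MatchingOddCutSosDegree
import Literature.Computability.Complexity.Mod2SosDegreeProof
import HarnessLib

/-!
# Lasserre needs `Ω(n)` rounds for the odd-cut inequalities of the matching polytope
# (BBCHPRRWZ 2017, Thm 4.11 / §4.5) — unconditional

Braun–Brown-Cohen–Huq–Pokutta–Raghavendra–Roy–Weitz–Zink, *The matching problem has no small
symmetric SDP*, Math. Program. 165 (2017), §4.5 (with Thm. 4.11 and Grigoriev's degree bound for
`MOD 2`, [Grigoriev 2001, Cor. 2]): the degree of any SOS certificate of an odd-cut inequality
`x(δ(U)) ≥ 1` from the perfect-matching constraints of `K_n` is linear in `|U|`.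
`MatchingOddCutSosDegree.lean` proves this from the named fact `Grigoriev2001_mod2Degree`
(`oddCutSOSDegreeLinear_of`); `Mod2SosDegreeProof.lean` proves the named fact
(`Grigoriev2001_mod2Degree_holds`). This file records the unconditional statement — the cell's
typed `OddCutSOSDegreeLinear` (HOME/pnp-psdrank-p2/Sketch-v2.lean §2b, verbatim).

## References

* G. Braun et al., *The matching problem has no small symmetric SDP*, Math. Program. 165 (2017)
  643–662, Thm. 4.11 and §4.5 (arXiv:1504.00703, pp. 10–11). [BraunEtAl2016]
* D. Grigoriev, *Linear lower bound on degrees of Positivstellensatz calculus proofs for the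
  parity*, Theoret. Comput. Sci. 259 (2001) 613–622, Cor. 2. [Grigoriev2001TCS]
-/

noncomputable section

open MvPolynomial Finset

namespace Literature.Computability.Complexity

/-- **`OddCutSOSDegreeLinear`, unconditionally**: there are `c > 0` and `t₀` such that for even
`n` and odd `U ⊆ [n]` with `t₀ ≤ |U|`, `2|U| ≤ n`, every SOS certificate of `x(δ(U)) - 1 ≥ 0` from
the matching constraints `𝒫_n` has degree `2d ≥ c·|U|`.
[cite: BraunEtAl2016, Thm. 4.11 with §4.5] -/
theorem oddCutSOSDegreeLinear :
    ∃ c : ℝ, 0 < c ∧ ∃ t₀ : ℕ, ∀ n : ℕ, Even n → ∀ U : Finset (Fin n), Odd U.card → t₀ ≤ U.card →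
      2 * U.card ≤ n → ∀ d : ℕ, HasSOSCertificate (Mod2.system n) (cutPoly U) d →
        c * U.card ≤ 2 * d :=
  oddCutSOSDegreeLinear_of Grigoriev2001_mod2Degree_holds

end Literature.Computability.Complexity
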